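import Mathlib
import Literature.Barriers.NavierStokesRegularity.DyadicCascadeRegularity
import Literature.Analysis.FluidPDE.Tao2016AveragedNS.SelfSimilarCascadeBlowup
import HarnessLib

/-!
# Cheskidov–Zaya: the sub-Onsager (`θ = 3/5`) regularising ceiling for positive solutions of the
# inviscid dyadic model at base `2`

Source: A. Cheskidov, K. Zaya, *Regularizing effect of the forward energy cascade in the inviscid
dyadic model*, Proc. Amer. Math. Soc. 144 (2016) 73–85 = arXiv:1310.7612 (bib key
`CheskidovZaya2013`; locators are the arXiv pages).  Companion (solution class, scaling, sign
symmetry, uniqueness): D. Barbato, F. Morandin, *Positive and non-positive solutions for an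
inviscid dyadic model: well-posedness and regularity*, NoDEA 20 (2013) 1105–1123 =
arXiv:1201.2693 (`BarbatoMorandin2012`).

## What is printed

* (1.3), p. 3: the inviscid system `ȧ_j = λ_{j-1}^{5/2} a_{j-1}² − λ_j^{5/2} a_j a_{j+1}`, `j ≥ 1`,
  `a_0 ≡ 0`, `λ_j = 2^j`, data `a(0) ∈ l²` (§2: `H = l²`); p. 4: a solution is *positive* if
  `a_j(t) ≥ 0` for all `j` and all `t`; Thm. 2.1 (positivity propagates, [BM13]); §3: solutions are
  `H`-valued with `a_j ∈ C¹`, obtained as limits of Galerkin systems (Thm. 3.1), and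
  **Lemma 3.2** (scaling): `a` solves (1.3) ⇒ `ã(t) = η a(η t)` solves (1.3).
* §4, p. 7: `c_j(t) := λ^{2θ−5/2} λ_j^θ a_j(t)` with `λ = 2`, **`θ = 3/5`** (so
  `c_j = 2^{−13/10}·2^{3j/5} a_j`).  **Theorem 4.1**: "Let `a(t)` be a positive solution to (1.3).
  There exists `δ > 0` such that if `c_j(0) ≤ δ < 1` for any `j ∈ ℕ`, then `c_j(t) < 1` for any
  `j ∈ ℕ` and for all `t > 0`."  Proof pp. 7–9: Galerkin truncation, first-crossing mode `n`,
  Gronwall comparisons for `b_{n±1}`, an explicit majorant `β(t)` of `b_n`; the proof CLOSES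
  NUMERICALLY ("`B(δ) → … > 0.447`"; "it suffices to show `β(t) < 1` on a finite interval, which can
  be accomplished easily numerically since `β(t)` is given explicitly") — no error-controlled
  evaluation is printed; the theorem is vendored as a named fact with this caveat recorded.
* **Theorem 4.2**, p. 9 ("our main result"): for a positive solution with
  `sup_j λ_j^θ a_j(0) = M < ∞`, `sup_j λ_j^θ a_j(t) < M/δ` for all `t > 0`; printed proof = Lemma 3.2
  with `η = δ/M` + Thm. 4.1.  (At `M = 0` the printed strict inequality fails for the zero
  solution; the corollary below assumes `M > 0`, which is what the printed proof uses.)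
* Thm. 1.1 / Cor. 4.3 (`sup_j λ_j^{3/5} a_j(t) < k|a(0)|^{2/3} t^{−1/3}`, via the measure estimate of
  [BM13] Thm. 10) and Thm. 2.2 (Onsager criterion for energy conservation) are NOT typed here.

## Transcription

The system (1.3) is, verbatim, the tree's Barbato–Morandin–Romito weak-solution predicate
`Literature.Barriers.NavierStokesRegularity.Dyadic.IsBMRWeakSolution ν β x a` at `ν = 0`,
`β = 5/2` (BMR (1.1): modes `n ≥ 1`, `λ_n = 2^n`, `λ_0 = 0`, so the feed into mode `1` vanishes —
the rôle of CZ's frozen `a_0 ≡ 0`; weak solution = each `a_n`, `n ≥ 1`, differentiable on `[0,∞)`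
with the prescribed derivative, [BM13] Def. 1 / BMR Def. 3.1), together with positivity
`a_n(t) ≥ 0` (`n ≥ 1`, `t ≥ 0`) and an `l²` datum.  By [BM13] Thm. 13 (uniqueness of weak solutions
for non-negative `l²` data, every `β > 1`) this class is exactly the class of CZ's Galerkin-limit
solutions used in the printed proof of Thm. 4.1 ("By the uniqueness proved in [BM13] and by
Theorem 3.1 …", p. 7).

* `CheskidovZaya2013_thm41` — Thm. 4.1 as printed (NAMED FACT, the only unproved declaration).
* `inviscidDyadic_weak_scaling` — Lemma 3.2 for inviscid BMR weak solutions (proved).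
* `CheskidovZaya2013_thm41.thm42` — Thm. 4.2 from Thm. 4.1 by the printed scaling argument (proved).
* `CheskidovZaya2013_thm41.dyadicTable_weightedCeiling` — the same ceiling transported to the
  tree's cascade vocabulary: component `0` of an inviscid (`ν = 0`) solution of the lattice of
  `TaoCascade.dyadicTable` at scale ratio `1 + ε₀ = 2`
  (`Ẋ_{0,n} = quadTerm 1 dyadicTable X 0 n = 2^{5(n−1)/2}X_{0,n−1}² − 2^{5n/2}X_{0,n}X_{0,n+1}`,
  `TaoCascade.quadTerm_dyadicTable_zero`) with `X_{0,−1} ≡ 0`, shells `≥ 1` non-negative and a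
  sign-constant shell `0`, obeys `2^{3n/5}|X_{0,n}(t)| < M/δ` for all `n ≥ 0`, `t ≥ 0` whenever
  `2^{3n/5}|X_{0,n}(0)| ≤ M` (`M > 0`).  Dictionary (proved inline): `a_j := 2^{−5/2}·Y_{j−1}`,
  `Y = X` with the sign of shell `0` flipped if needed ([BM13] Prop. 2: flipping the first
  non-zero component and the scaling `W_n(t) = αX_n(αt)` preserve weak solutions); the weighted
  supremum is scale- and shift-covariant, so the constant `δ` is unchanged.
* `CheskidovZaya2013_thm41.dyadicTable_tailCeiling` — one-shell data `X_{0,n}(0) = X₀·[n = 0]`: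
  `Σ_{k=n}^{N} ½X_{0,k}(t)² ≤ C·(½X₀²)·2^{−2θn}`, `θ = 3/5`, `C = 1/(δ²(1 − 2^{−6/5}))`, for all
  `n ≤ N`, `t ≥ 0` — the shape of the route item `DyadicTailCeiling` (Summits side) at scale ratio
  `2` WITHOUT viscosity (the printed theorem is inviscid; nothing here is claimed for `ν > 0`).

HONEST FRAMING: statements about a MODEL lattice ODE; nothing in this file is a statement about
the Euler or Navier–Stokes equations.  One named fact (`CheskidovZaya2013_thm41`, published with a
numerical closing step); everything else is proved from it or outright.
-/

noncomputable section

open Set Filter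
open scoped BigOperators Topology

namespace Literature.Analysis.FluidPDE

open Literature.Barriers.NavierStokesRegularity.Dyadic

/-! ### The named fact: Cheskidov–Zaya Theorem 4.1 -/

/-- **Cheskidov–Zaya, Theorem 4.1** (arXiv:1310.7612 = Proc. AMS 144 (2016)), as printed.  The
inviscid dyadic system (1.3) `ȧ_j = λ_{j−1}^{5/2}a_{j−1}² − λ_j^{5/2}a_ja_{j+1}` (`j ≥ 1`, `a_0 ≡ 0`,
`λ_j = 2^j`) is the tree's `IsBMRWeakSolution 0 (5/2)` (BMR (1.1) at `ν = 0`, `β = 5/2`); a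
*positive solution* has `a_j(t) ≥ 0` for all `j ≥ 1`, `t ≥ 0`, and an `l²` datum (§2–§3).  With
`c_j(t) = λ^{2θ−5/2}λ_j^θ a_j(t) = 2^{−13/10}·2^{3j/5}a_j(t)` (`θ = 3/5`, (4.2)): "There exists
`δ > 0` such that if `c_j(0) ≤ δ < 1` for any `j ∈ ℕ`, then `c_j(t) < 1` for any `j ∈ ℕ` and for
all `t > 0`."  CAVEAT (recorded, not hidden): the printed proof closes with a numerical evaluation
of an explicit function (`β(t) < 1` on a finite interval; `B(δ) > 0.447`), pp. 8–9.
[cite: CheskidovZaya2013, §4 Thm. 4.1 p.7 (system (1.3) p.3; positive solution §2 p.4; (4.1)–(4.2) p.7)]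
[cite: BarbatoMorandin2012, §1 Def. 1 (weak solution) and §4 Thm. 13 (uniqueness for non-negative `l²` data)] -/
def CheskidovZaya2013_thm41 : Prop :=
  ∃ δ : ℝ, 0 < δ ∧ δ < 1 ∧
    ∀ (x : ℕ → ℝ) (a : ℕ → ℝ → ℝ),
      Summable (fun n => x n ^ 2) →
      IsBMRWeakSolution 0 (5 / 2) x a →
      (∀ n : ℕ, 1 ≤ n → ∀ t : ℝ, 0 ≤ t → 0 ≤ a n t) →
      (∀ n : ℕ, 1 ≤ n → (2 : ℝ) ^ (-(13 : ℝ) / 10) * ((2 : ℝ) ^ ((3 : ℝ) / 5 * n) * x n) ≤ δ) →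
      ∀ n : ℕ, 1 ≤ n → ∀ t : ℝ, 0 < t →
        (2 : ℝ) ^ (-(13 : ℝ) / 10) * ((2 : ℝ) ^ ((3 : ℝ) / 5 * n) * a n t) < 1

/-! ### Lemma 3.2: scaling covariance of inviscid weak solutions -/

/-- The inviscid BMR right-hand side is quadratic: scaling the amplitudes by `η` scales it by `η²`.
[cite: CheskidovZaya2013, §3 Lemma 3.2 p.6] -/
theorem bmrRHS_inviscid_smul (β η : ℝ) (X : ℕ → ℝ) (n : ℕ) :
    bmrRHS 0 β (fun m => η * X m) n = η ^ 2 * bmrRHS 0 β X n := by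
  simp only [bmrRHS, neg_zero, zero_mul, zero_add]
  ring

/-- **Cheskidov–Zaya Lemma 3.2 / Barbato–Morandin Prop. 2** (scaling): if `a` is an inviscid weak
solution with datum `x`, then `t ↦ η a(η t)` (`η > 0`) is an inviscid weak solution with datum
`η x`. [cite: CheskidovZaya2013, §3 Lemma 3.2 p.6] [cite: BarbatoMorandin2012, §1 Prop. 2] -/
theorem inviscidDyadic_weak_scaling {β : ℝ} {x : ℕ → ℝ} {a : ℕ → ℝ → ℝ}
    (ha : IsBMRWeakSolution 0 β x a) {η : ℝ} (hη : 0 < η) :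
    IsBMRWeakSolution 0 β (fun n => η * x n) (fun n t => η * a n (η * t)) := by
  refine ⟨fun n hn => by simp [ha.1 n hn], fun n hn t ht => ?_⟩
  have hηt : 0 ≤ η * t := by positivity
  have hd := ha.2 n hn (η * t) hηt
  -- chain rule with the affine clock `s ↦ η s`, which maps `[0,∞)` into itself
  have hlin : HasDerivWithinAt (fun s : ℝ => η * s) η (Ici 0) t := by
    simpa using (hasDerivWithinAt_id t (Ici (0 : ℝ))).const_mul η
  have hmaps : MapsTo (fun s : ℝ => η * s) (Ici 0) (Ici 0) := fun s hs => by
    simp only [mem_Ici] at hs ⊢; positivity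
  have hcomp := HasDerivWithinAt.comp t hd hlin hmaps
  have hfin := hcomp.const_mul η
  have hfun : (fun s => η * (a n ∘ fun s : ℝ => η * s) s) = fun s => η * a n (η * s) := by
    funext s; rfl
  rw [hfun] at hfin
  refine hfin.congr_deriv ?_
  simp only [bmrRHS, neg_zero, zero_mul, zero_add]
  ring

/-! ### Theorem 4.2 from Theorem 4.1 (the printed scaling argument) -/

/-- **Cheskidov–Zaya, Theorem 4.2** (from Thm. 4.1, as printed: rescale by `η = 2^{13/10}δ/M` via
Lemma 3.2): for every positive inviscid solution with `l²` datum and `2^{3j/5}a_j(0) ≤ M` for all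
`j ≥ 1` (`M > 0`), `2^{3j/5}a_j(t) < M/δ` for all `j ≥ 1` and all `t ≥ 0`, with the `δ ∈ (0,1)` of
Theorem 4.1. [cite: CheskidovZaya2013, §4 Thm. 4.2 p.9 (proof via Lemma 3.2)] -/
theorem CheskidovZaya2013_thm41.thm42 (h : CheskidovZaya2013_thm41) :
    ∃ δ : ℝ, 0 < δ ∧ δ < 1 ∧
      ∀ (x : ℕ → ℝ) (a : ℕ → ℝ → ℝ),
        Summable (fun n => x n ^ 2) →
        IsBMRWeakSolution 0 (5 / 2) x a →
        (∀ n : ℕ, 1 ≤ n → ∀ t : ℝ, 0 ≤ t → 0 ≤ a n t) →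
        ∀ M : ℝ, 0 < M → (∀ n : ℕ, 1 ≤ n → (2 : ℝ) ^ ((3 : ℝ) / 5 * n) * x n ≤ M) →
        ∀ n : ℕ, 1 ≤ n → ∀ t : ℝ, 0 ≤ t → (2 : ℝ) ^ ((3 : ℝ) / 5 * n) * a n t < M / δ := by
  obtain ⟨δ, hδ0, hδ1, H⟩ := h
  refine ⟨δ, hδ0, hδ1, fun x a hx ha hpos M hM hbd n hn t ht => ?_⟩
  have hw : 0 < (2 : ℝ) ^ ((3 : ℝ) / 5 * n) := Real.rpow_pos_of_pos two_pos _
  have hK : 0 < (2 : ℝ) ^ (-(13 : ℝ) / 10) := Real.rpow_pos_of_pos two_pos _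
  have hKK : (2 : ℝ) ^ (-(13 : ℝ) / 10) * (2 : ℝ) ^ ((13 : ℝ) / 10) = 1 := by
    rw [← Real.rpow_add two_pos]; norm_num
  rcases ht.eq_or_lt with rfl | htpos
  · -- `t = 0`: `2^{3j/5}a_j(0) ≤ M < M/δ`
    rw [ha.1 n hn]
    have : M < M / δ := by
      rw [lt_div_iff₀ hδ0]; nlinarith
    exact (hbd n hn).trans_lt this
  · -- `t > 0`: rescale
    set η : ℝ := (2 : ℝ) ^ ((13 : ℝ) / 10) * δ / M with hη
    have hη0 : 0 < η := by positivity
    have hsc := inviscidDyadic_weak_scaling ha hη0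
    have hsum : Summable (fun n => (η * x n) ^ 2) := by
      simpa only [mul_pow] using hx.mul_left (η ^ 2)
    have hpos' : ∀ n : ℕ, 1 ≤ n → ∀ t : ℝ, 0 ≤ t → 0 ≤ η * a n (η * t) := fun n hn t ht =>
      mul_nonneg hη0.le (hpos n hn _ (by positivity))
    have hbd' : ∀ n : ℕ, 1 ≤ n →
        (2 : ℝ) ^ (-(13 : ℝ) / 10) * ((2 : ℝ) ^ ((3 : ℝ) / 5 * n) * (η * x n)) ≤ δ := by
      intro m hm
      have h1 := hbd m hm
      calc (2 : ℝ) ^ (-(13 : ℝ) / 10) * ((2 : ℝ) ^ ((3 : ℝ) / 5 * m) * (η * x m))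
          = ((2 : ℝ) ^ (-(13 : ℝ) / 10) * (2 : ℝ) ^ ((13 : ℝ) / 10)) * (δ / M) *
              ((2 : ℝ) ^ ((3 : ℝ) / 5 * m) * x m) := by rw [hη]; ring
        _ ≤ 1 * (δ / M) * M := by
              rw [hKK]; exact mul_le_mul_of_nonneg_left h1 (by positivity)
        _ = δ := by field_simp
    have hs : 0 < t / η := div_pos htpos hη0
    have key := H (fun n => η * x n) (fun n t => η * a n (η * t)) hsum hsc hpos' hbd' n hn
      (t / η) hs
    have hηt : η * (t / η) = t := by field_simp
    simp only [hηt] at key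
    -- `2^{-13/10}·2^{3n/5}·η·a < 1` ⇒ `2^{3n/5} a < 2^{13/10}/η = M/δ`
    have hval : (2 : ℝ) ^ ((3 : ℝ) / 5 * n) * a n t =
        ((2 : ℝ) ^ (-(13 : ℝ) / 10) * ((2 : ℝ) ^ ((3 : ℝ) / 5 * n) * (η * a n t))) *
          (M / δ) := by
      have : (2 : ℝ) ^ (-(13 : ℝ) / 10) * η * (M / δ) = 1 := by
        rw [hη]
        have hδM : δ / M * (M / δ) = 1 := by field_simp
        calc (2 : ℝ) ^ (-(13 : ℝ) / 10) * ((2 : ℝ) ^ ((13 : ℝ) / 10) * δ / M) * (M / δ)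
            = ((2 : ℝ) ^ (-(13 : ℝ) / 10) * (2 : ℝ) ^ ((13 : ℝ) / 10)) * (δ / M * (M / δ)) := by
              ring
          _ = 1 := by rw [hKK, hδM, one_mul]
      calc (2 : ℝ) ^ ((3 : ℝ) / 5 * n) * a n t
          = ((2 : ℝ) ^ (-(13 : ℝ) / 10) * η * (M / δ)) * ((2 : ℝ) ^ ((3 : ℝ) / 5 * n) * a n t) := by
            rw [this, one_mul]
        _ = _ := by ring
    rw [hval]
    have hMδ : 0 < M / δ := div_pos hM hδ0
    calc (2 : ℝ) ^ (-(13 : ℝ) / 10) * ((2 : ℝ) ^ ((3 : ℝ) / 5 * n) * (η * a n t)) * (M / δ)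
        < 1 * (M / δ) := mul_lt_mul_of_pos_right key hMδ
      _ = M / δ := one_mul _

/-! ### Transport to the tree's cascade vocabulary (`TaoCascade.dyadicTable`, scale ratio `2`, `ν = 0`) -/

/-- Powers of two combine. [folklore] -/
private theorem czTwo_rpow_mul (a b : ℝ) : (2 : ℝ) ^ a * (2 : ℝ) ^ b = (2 : ℝ) ^ (a + b) :=
  (Real.rpow_add two_pos a b).symm

/-- `λ_m^{5/2} = 2^{(5/2)m}` for `m ≥ 1`. [folklore] -/
private theorem czLambda_rpow {m : ℕ} (hm : m ≠ 0) (r : ℝ) :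
    bmrLambda m ^ r = (2 : ℝ) ^ ((m : ℝ) * r) := by
  rw [bmrLambda_of_ne_zero hm, ← Real.rpow_natCast, ← Real.rpow_mul (by norm_num : (0:ℝ) ≤ 2)]

/-- The coefficient identity behind the dictionary `a_j = 2^{−5/2}X_{j−1}`:
`2^{e}·κ² = κ·2^{e − 5/2}` with `κ = 2^{−5/2}`. [folklore] -/
private theorem czKappa_identity (e : ℝ) :
    (2 : ℝ) ^ e * ((2 : ℝ) ^ (-(5 : ℝ) / 2) * (2 : ℝ) ^ (-(5 : ℝ) / 2)) =
      (2 : ℝ) ^ (-(5 : ℝ) / 2) * (2 : ℝ) ^ (e - 5 / 2) := by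
  rw [czTwo_rpow_mul, czTwo_rpow_mul, czTwo_rpow_mul]
  congr 1
  ring

/-- **Cheskidov–Zaya Thm. 4.2 in the tree's cascade vocabulary.**  Let `X : Fin 4 → ℤ → ℝ → ℝ` be
such that component `0` solves, on `[0,∞)`, the INVISCID lattice of the dyadic table at scale ratio
`1 + ε₀ = 2` on the shells `n ≥ 0` (`Ẋ_{0,n} = quadTerm 1 dyadicTable X 0 n`, i.e.
`2^{5(n−1)/2}X_{0,n−1}² − 2^{5n/2}X_{0,n}X_{0,n+1}`), with `X_{0,−1} ≡ 0` on `[0,∞)` (no feed from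
below shell `0`), square-summable datum, shells `≥ 1` non-negative and shell `0` of constant sign
on `[0,∞)`.  Then, with the `δ ∈ (0,1)` of Theorem 4.1: for every `M > 0` with
`2^{3n/5}|X_{0,n}(0)| ≤ M` for all `n ≥ 0`, one has `2^{3n/5}|X_{0,n}(t)| < M/δ` for all `n ≥ 0`
and `t ≥ 0`.  (Dictionary: `a_j := 2^{−5/2}·(±X_{0,j−1})` is a positive inviscid BMR weak solution;
[BM13] Prop. 2.)
[cite: CheskidovZaya2013, §4 Thm. 4.2 p.9 and §3 Lemma 3.2 p.6]
[cite: BarbatoMorandin2012, §1 Prop. 2 (scaling; sign flip of the first non-zero component)]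
[cite: Tao2016AveragedNS, §1.2 (the dyadic model system) and §4 (4.4)] -/
theorem CheskidovZaya2013_thm41.dyadicTable_weightedCeiling (h : CheskidovZaya2013_thm41) :
    ∃ δ : ℝ, 0 < δ ∧ δ < 1 ∧
      ∀ X : Fin 4 → ℤ → ℝ → ℝ,
        (∀ (k : ℕ) (t : ℝ), 0 ≤ t →
          HasDerivWithinAt (X 0 k) (TaoCascade.quadTerm 1 TaoCascade.dyadicTable X 0 k t)
            (Ici 0) t) →
        (∀ t : ℝ, 0 ≤ t → X 0 (-1) t = 0) →
        Summable (fun k : ℕ => X 0 k 0 ^ 2) →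
        ((∀ t : ℝ, 0 ≤ t → 0 ≤ X 0 0 t) ∨ (∀ t : ℝ, 0 ≤ t → X 0 0 t ≤ 0)) →
        (∀ k : ℕ, 1 ≤ k → ∀ t : ℝ, 0 ≤ t → 0 ≤ X 0 k t) →
        ∀ M : ℝ, 0 < M → (∀ k : ℕ, (2 : ℝ) ^ ((3 : ℝ) / 5 * k) * |X 0 k 0| ≤ M) →
        ∀ (k : ℕ) (t : ℝ), 0 ≤ t → (2 : ℝ) ^ ((3 : ℝ) / 5 * k) * |X 0 k t| < M / δ := by
  obtain ⟨δ, hδ0, hδ1, H⟩ := h.thm42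
  refine ⟨δ, hδ0, hδ1, fun X hlaw hlow hsum hsign hpos M hM hbd k t ht => ?_⟩
  -- the sign of shell `0`
  obtain ⟨s, hs, hs0⟩ : ∃ s : ℝ, (s = 1 ∨ s = -1) ∧ ∀ t : ℝ, 0 ≤ t → 0 ≤ s * X 0 0 t := by
    rcases hsign with hp | hn
    · exact ⟨1, Or.inl rfl, fun t ht => by simpa using hp t ht⟩
    · exact ⟨-1, Or.inr rfl, fun t ht => by have := hn t ht; linarith⟩
  have hs2 : s ^ 2 = 1 := by rcases hs with rfl | rfl <;> norm_num
  have habs_s : |s| = 1 := by rcases hs with rfl | rfl <;> norm_num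
  -- `Y` = `X 0` with shell `0` sign-corrected
  set Y : ℤ → ℝ → ℝ := fun n => if n = 0 then (fun t => s * X 0 0 t) else X 0 n with hYdef
  have hY0 : Y 0 = fun t => s * X 0 0 t := by simp [hYdef]
  have hYne : ∀ n : ℤ, n ≠ 0 → Y n = X 0 n := fun n hn => by simp [hYdef, hn]
  have hYabs : ∀ (n : ℤ) (t : ℝ), |Y n t| = |X 0 n t| := by
    intro n t
    by_cases hn : n = 0
    · subst hn; rw [hY0]; simp [abs_mul, habs_s]
    · rw [hYne n hn]
  have hYsq : ∀ (n : ℤ) (t : ℝ), Y n t ^ 2 = X 0 n t ^ 2 := fun n t => by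
    rw [← sq_abs, hYabs, sq_abs]
  have hYnonneg : ∀ (k : ℕ) (t : ℝ), 0 ≤ t → 0 ≤ Y k t := by
    intro k t ht
    rcases Nat.eq_zero_or_pos k with rfl | hk
    · simp only [Nat.cast_zero, hY0]; exact hs0 t ht
    · rw [hYne k (by exact_mod_cast hk.ne')]; exact hpos k hk t ht
  have hYm1 : ∀ t : ℝ, 0 ≤ t → Y (-1) t = 0 := fun t ht => by
    rw [hYne (-1) (by norm_num)]; exact hlow t ht
  -- the lattice law for `Y` on shells `k ≥ 0`
  have hYlaw : ∀ (k : ℕ) (t : ℝ), 0 ≤ t →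
      HasDerivWithinAt (Y k)
        ((2 : ℝ) ^ ((5 : ℝ) * ((k : ℝ) - 1) / 2) * Y ((k : ℤ) - 1) t ^ 2 -
          (2 : ℝ) ^ ((5 : ℝ) * (k : ℝ) / 2) * (Y k t * Y ((k : ℤ) + 1) t)) (Ici 0) t := by
    intro k t ht
    have hd := hlaw k t ht
    rw [TaoCascade.quadTerm_dyadicTable_zero] at hd
    push_cast at hd
    rw [one_add_one_eq_two] at hd
    rcases Nat.lt_trichotomy k 1 with hk | rfl | hk
    · -- `k = 0`
      obtain rfl : k = 0 := by omega
      simp only [Nat.cast_zero, zero_sub, zero_add] at hd ⊢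
      rw [hY0, hYne 1 one_ne_zero, hYne (-1) (by norm_num)]
      refine (hd.const_mul s).congr_deriv ?_
      beta_reduce
      rw [hlow t ht]
      ring
    · -- `k = 1`
      simp only [Nat.cast_one, sub_self] at hd ⊢
      rw [hYne 1 one_ne_zero, hY0, hYne ((1 : ℤ) + 1) (by norm_num)]
      refine hd.congr_deriv ?_
      beta_reduce
      rw [mul_pow, hs2, one_mul]
    · -- `k ≥ 2`
      have hk0 : (k : ℤ) ≠ 0 := by omega
      have hk1 : (k : ℤ) - 1 ≠ 0 := by omega
      have hk2 : (k : ℤ) + 1 ≠ 0 := by omega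
      rw [hYne k hk0, hYne _ hk1, hYne _ hk2]
      exact hd
  -- the dictionary: `a_j = κ·Y_{j-1}`
  set κ : ℝ := (2 : ℝ) ^ (-(5 : ℝ) / 2) with hκ
  have hκ0 : 0 < κ := Real.rpow_pos_of_pos two_pos _
  set a : ℕ → ℝ → ℝ := fun j t => κ * Y ((j : ℤ) - 1) t with hadef
  have ha_succ : ∀ k : ℕ, a (k + 1) = fun t => κ * Y k t := by
    intro k; funext t
    simp only [hadef, Nat.cast_add, Nat.cast_one, add_sub_cancel_right]
  have ha_succ' : ∀ (k : ℕ) (t : ℝ), a (k + 1) t = κ * Y k t := fun k t => by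
    rw [ha_succ k]
  -- `a` is an inviscid BMR weak solution with `β = 5/2`
  have hsol : IsBMRWeakSolution 0 (5 / 2) (fun j => a j 0) a := by
    refine ⟨fun n _ => rfl, fun j hj t ht => ?_⟩
    obtain ⟨k, rfl⟩ : ∃ k, j = k + 1 := ⟨j - 1, by omega⟩
    rw [ha_succ k]
    refine ((hYlaw k t ht).const_mul κ).congr_deriv ?_
    -- unfold the BMR right-hand side at mode `k+1`
    have hidx2 : (((k + 1 + 1 : ℕ) : ℤ) - 1) = (k : ℤ) + 1 := by push_cast; ring
    have hak : a k t = κ * Y ((k : ℤ) - 1) t := rfl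
    have hak2 : a (k + 1 + 1) t = κ * Y ((k : ℤ) + 1) t := by simp only [hadef, hidx2]
    simp only [bmrRHS, neg_zero, zero_mul, zero_add, Nat.add_sub_cancel]
    rw [hak, ha_succ' k t, hak2]
    rcases Nat.eq_zero_or_pos k with rfl | hk
    · -- mode `1`: no feed (`λ_0 = 0`), drain coefficient `λ_1^{5/2}κ² = κ`
      have hE : Y (((0 : ℕ) : ℤ) - 1) t = 0 := by simpa using hYm1 t ht
      have hB : (2 : ℝ) ^ ((5 : ℝ) * ((0 : ℕ) : ℝ) / 2) = 1 := by simp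
      have hC : bmrLambda 0 ^ ((5 : ℝ) / 2) = 0 := by
        rw [bmrLambda_zero, Real.zero_rpow (by norm_num)]
      have hD : bmrLambda (0 + 1) ^ ((5 : ℝ) / 2) * (κ * κ) = κ := by
        rw [czLambda_rpow (by norm_num) ((5 : ℝ) / 2), hκ, czKappa_identity]
        norm_num
      rw [hE, hC]
      linear_combination (-(κ * (Y ((0 : ℕ) : ℤ) t * Y (((0 : ℕ) : ℤ) + 1) t))) * hB +
        (Y ((0 : ℕ) : ℤ) t * Y (((0 : ℕ) : ℤ) + 1) t) * hD
    · -- modes `≥ 2`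
      have hkne : k ≠ 0 := hk.ne'
      have hc1 : bmrLambda k ^ ((5 : ℝ) / 2) * (κ * κ) =
          κ * (2 : ℝ) ^ ((5 : ℝ) * ((k : ℝ) - 1) / 2) := by
        rw [czLambda_rpow hkne, hκ, czKappa_identity]
        have : (k : ℝ) * ((5 : ℝ) / 2) - 5 / 2 = (5 : ℝ) * ((k : ℝ) - 1) / 2 := by ring
        rw [this]
      have hc2 : bmrLambda (k + 1) ^ ((5 : ℝ) / 2) * (κ * κ) =
          κ * (2 : ℝ) ^ ((5 : ℝ) * (k : ℝ) / 2) := by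
        rw [czLambda_rpow (Nat.succ_ne_zero k), hκ, czKappa_identity]
        have : ((k + 1 : ℕ) : ℝ) * ((5 : ℝ) / 2) - 5 / 2 = (5 : ℝ) * (k : ℝ) / 2 := by
          push_cast; ring
        rw [this]
      linear_combination (-(Y ((k : ℤ) - 1) t ^ 2)) * hc1 +
        (Y (k : ℤ) t * Y ((k : ℤ) + 1) t) * hc2
  -- positivity, `l²` datum and the weighted datum bound for `a`
  have hapos : ∀ n : ℕ, 1 ≤ n → ∀ t : ℝ, 0 ≤ t → 0 ≤ a n t := by
    intro j hj t ht
    obtain ⟨k, rfl⟩ : ∃ k, j = k + 1 := ⟨j - 1, by omega⟩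
    rw [ha_succ' k t]
    exact mul_nonneg hκ0.le (hYnonneg k t ht)
  have hasum : Summable (fun j => a j 0 ^ 2) := by
    refine (summable_nat_add_iff 1).mp ?_
    have : (fun j : ℕ => a (j + 1) 0 ^ 2) = fun j : ℕ => κ ^ 2 * X 0 (j : ℤ) 0 ^ 2 := by
      funext j; rw [ha_succ' j 0, mul_pow, hYsq]
    rw [this]
    exact hsum.mul_left _
  set Ma : ℝ := (2 : ℝ) ^ ((3 : ℝ) / 5) * κ * M with hMa
  have hw35 : 0 < (2 : ℝ) ^ ((3 : ℝ) / 5) := Real.rpow_pos_of_pos two_pos _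
  have hMa0 : 0 < Ma := by positivity
  have hwsplit : ∀ k : ℕ, (2 : ℝ) ^ ((3 : ℝ) / 5 * ((k + 1 : ℕ) : ℝ)) =
      (2 : ℝ) ^ ((3 : ℝ) / 5) * (2 : ℝ) ^ ((3 : ℝ) / 5 * k) := by
    intro k
    rw [czTwo_rpow_mul]; congr 1; push_cast; ring
  have habd : ∀ n : ℕ, 1 ≤ n → (2 : ℝ) ^ ((3 : ℝ) / 5 * n) * a n 0 ≤ Ma := by
    intro j hj
    obtain ⟨k, rfl⟩ : ∃ k, j = k + 1 := ⟨j - 1, by omega⟩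
    rw [ha_succ' k 0, hwsplit k]
    have hYle : Y k 0 ≤ |X 0 k 0| := by rw [← hYabs]; exact le_abs_self _
    have hwk : 0 ≤ (2 : ℝ) ^ ((3 : ℝ) / 5 * k) := (Real.rpow_pos_of_pos two_pos _).le
    calc (2 : ℝ) ^ ((3 : ℝ) / 5) * (2 : ℝ) ^ ((3 : ℝ) / 5 * k) * (κ * Y k 0)
        = (2 : ℝ) ^ ((3 : ℝ) / 5) * κ * ((2 : ℝ) ^ ((3 : ℝ) / 5 * k) * Y k 0) := by ring
      _ ≤ (2 : ℝ) ^ ((3 : ℝ) / 5) * κ * ((2 : ℝ) ^ ((3 : ℝ) / 5 * k) * |X 0 k 0|) := by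
          gcongr
      _ ≤ (2 : ℝ) ^ ((3 : ℝ) / 5) * κ * M := by gcongr; exact hbd k
  -- apply Theorem 4.2 at mode `k+1`
  have key := H (fun j => a j 0) a hasum hsol hapos Ma hMa0 habd (k + 1) (by omega) t ht
  rw [ha_succ' k t, hwsplit k] at key
  have hYk : |X 0 k t| = Y k t := by
    rw [← hYabs, abs_of_nonneg (hYnonneg k t ht)]
  rw [hYk]
  -- divide by `2^{3/5} κ > 0`
  have hc : 0 < (2 : ℝ) ^ ((3 : ℝ) / 5) * κ := by positivity
  have key' : ((2 : ℝ) ^ ((3 : ℝ) / 5) * κ) * ((2 : ℝ) ^ ((3 : ℝ) / 5 * k) * Y k t) <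
      ((2 : ℝ) ^ ((3 : ℝ) / 5) * κ) * (M / δ) := by
    have : Ma / δ = ((2 : ℝ) ^ ((3 : ℝ) / 5) * κ) * (M / δ) := by rw [hMa]; ring
    rw [← this]
    calc ((2 : ℝ) ^ ((3 : ℝ) / 5) * κ) * ((2 : ℝ) ^ ((3 : ℝ) / 5 * k) * Y k t)
        = (2 : ℝ) ^ ((3 : ℝ) / 5) * (2 : ℝ) ^ ((3 : ℝ) / 5 * k) * (κ * Y k t) := by ring
      _ < Ma / δ := key
  exact lt_of_mul_lt_mul_left key' hc.le

/-- **Energy-tail form for one-shell data** (the shape of the Summits-side item `DyadicTailCeiling`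
at scale ratio `2`, but INVISCID): under the hypotheses of
`CheskidovZaya2013_thm41.dyadicTable_weightedCeiling` with the one-shell datum
`X_{0,k}(0) = X₀·[k = 0]`, for all `n ≤ N` and `t ≥ 0`,
`Σ_{k=n}^{N} ½X_{0,k}(t)² ≤ C·(½X₀²)·2^{−2θn}` with `θ = 3/5` and `C = 1/(δ²(1 − 2^{−6/5}))`.
[cite: CheskidovZaya2013, §4 Thm. 4.2 p.9 (geometric tail of the per-shell ceiling)]
[cite: Tao2016AveragedNS, §1.2 (dyadic model system)] -/
theorem CheskidovZaya2013_thm41.dyadicTable_tailCeiling (h : CheskidovZaya2013_thm41) :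
    ∃ δ : ℝ, 0 < δ ∧ δ < 1 ∧
      ∀ (X : Fin 4 → ℤ → ℝ → ℝ) (X₀ : ℝ),
        (∀ (k : ℕ) (t : ℝ), 0 ≤ t →
          HasDerivWithinAt (X 0 k) (TaoCascade.quadTerm 1 TaoCascade.dyadicTable X 0 k t)
            (Ici 0) t) →
        (∀ t : ℝ, 0 ≤ t → X 0 (-1) t = 0) →
        (∀ k : ℕ, X 0 k 0 = if k = 0 then X₀ else 0) →
        ((∀ t : ℝ, 0 ≤ t → 0 ≤ X 0 0 t) ∨ (∀ t : ℝ, 0 ≤ t → X 0 0 t ≤ 0)) →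
        (∀ k : ℕ, 1 ≤ k → ∀ t : ℝ, 0 ≤ t → 0 ≤ X 0 k t) →
        ∀ n N : ℕ, n ≤ N → ∀ t : ℝ, 0 ≤ t →
          ∑ k ∈ Finset.Icc n N, (1 / 2 : ℝ) * X 0 k t ^ 2 ≤
            (1 / (δ ^ 2 * (1 - (2 : ℝ) ^ (-(6 : ℝ) / 5)))) * ((1 / 2 : ℝ) * X₀ ^ 2) *
              (2 : ℝ) ^ (-(2 * (3 / 5 : ℝ) * (n : ℝ))) := by
  obtain ⟨δ, hδ0, hδ1, H⟩ := h.dyadicTable_weightedCeiling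
  refine ⟨δ, hδ0, hδ1, fun X X₀ hlaw hlow hinit hsign hpos n N _ t ht => ?_⟩
  have hsum : Summable (fun k : ℕ => X 0 k 0 ^ 2) := by
    refine summable_of_ne_finset_zero (s := {0}) fun k hk => ?_
    rw [Finset.mem_singleton] at hk
    rw [hinit k, if_neg hk]; ring
  -- per-shell ceiling with the optimal constant `|X₀|/δ`, by letting `M ↓ |X₀|`
  have hshell : ∀ k : ℕ, (2 : ℝ) ^ ((3 : ℝ) / 5 * k) * |X 0 k t| ≤ |X₀| / δ := by
    intro k
    refine le_of_forall_pos_lt_add fun ε hε => ?_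
    have hM : 0 < |X₀| + ε * δ := by positivity
    have hbd : ∀ k : ℕ, (2 : ℝ) ^ ((3 : ℝ) / 5 * k) * |X 0 k 0| ≤ |X₀| + ε * δ := by
      intro k
      rw [hinit k]
      split_ifs with hk
      · subst hk; simp only [Nat.cast_zero, mul_zero, Real.rpow_zero, one_mul]
        linarith [mul_pos hε hδ0]
      · simp only [abs_zero, mul_zero]; exact hM.le
    have := H X hlaw hlow hsum hsign hpos (|X₀| + ε * δ) hM hbd k t ht
    calc (2 : ℝ) ^ ((3 : ℝ) / 5 * k) * |X 0 k t| < (|X₀| + ε * δ) / δ := this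
      _ = |X₀| / δ + ε := by rw [add_div, mul_div_assoc, div_self hδ0.ne', mul_one]
  -- squares: `X_{0,k}(t)² ≤ (X₀/δ)²·r^k` with `r = 2^{-6/5}`
  set r : ℝ := (2 : ℝ) ^ (-(6 : ℝ) / 5) with hr
  have hr0 : 0 ≤ r := (Real.rpow_pos_of_pos two_pos _).le
  have hr1 : r < 1 := by
    rw [hr]
    exact Real.rpow_lt_one_of_one_lt_of_neg (by norm_num) (by norm_num)
  have hwr : ∀ k : ℕ, ((2 : ℝ) ^ ((3 : ℝ) / 5 * k)) ^ 2 * r ^ k = 1 := by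
    intro k
    rw [hr, ← Real.rpow_natCast ((2 : ℝ) ^ (-(6 : ℝ) / 5)) k,
      ← Real.rpow_mul (by norm_num : (0 : ℝ) ≤ 2), ← Real.rpow_natCast, ← Real.rpow_mul
      (by norm_num : (0 : ℝ) ≤ 2), czTwo_rpow_mul]
    have : (3 : ℝ) / 5 * k * (2 : ℕ) + -(6 : ℝ) / 5 * k = 0 := by push_cast; ring
    rw [this, Real.rpow_zero]
  have hsq : ∀ k : ℕ, X 0 k t ^ 2 ≤ (X₀ / δ) ^ 2 * r ^ k := by
    intro k
    have h1 := hshell k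
    have h0 : 0 ≤ (2 : ℝ) ^ ((3 : ℝ) / 5 * k) * |X 0 k t| := by positivity
    have h2 : ((2 : ℝ) ^ ((3 : ℝ) / 5 * k) * |X 0 k t|) ^ 2 ≤ (|X₀| / δ) ^ 2 :=
      pow_le_pow_left₀ h0 h1 2
    rw [mul_pow, sq_abs, div_pow, sq_abs] at h2
    have hrk : 0 ≤ r ^ k := pow_nonneg hr0 k
    calc X 0 k t ^ 2 = (((2 : ℝ) ^ ((3 : ℝ) / 5 * k)) ^ 2 * r ^ k) * X 0 k t ^ 2 := by
          rw [hwr k, one_mul]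
      _ = (((2 : ℝ) ^ ((3 : ℝ) / 5 * k)) ^ 2 * X 0 k t ^ 2) * r ^ k := by ring
      _ ≤ (X₀ ^ 2 / δ ^ 2) * r ^ k := mul_le_mul_of_nonneg_right h2 hrk
      _ = (X₀ / δ) ^ 2 * r ^ k := by rw [div_pow]
  -- geometric tail
  have hgeom : ∑ k ∈ Finset.Icc n N, r ^ k ≤ r ^ n / (1 - r) := by
    rw [← Finset.Ico_add_one_right_eq_Icc]
    exact geom_sum_Ico_le_of_lt_one hr0 hr1
  have hrn : r ^ n = (2 : ℝ) ^ (-(2 * (3 / 5 : ℝ) * (n : ℝ))) := by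
    rw [hr, ← Real.rpow_natCast, ← Real.rpow_mul (by norm_num : (0 : ℝ) ≤ 2)]
    congr 1; ring
  have h1r : 0 < 1 - r := sub_pos.mpr hr1
  calc ∑ k ∈ Finset.Icc n N, (1 / 2 : ℝ) * X 0 k t ^ 2
      ≤ ∑ k ∈ Finset.Icc n N, (1 / 2 : ℝ) * ((X₀ / δ) ^ 2 * r ^ k) := by
        gcongr with k hk
        exact hsq k
    _ = (1 / 2 : ℝ) * (X₀ / δ) ^ 2 * ∑ k ∈ Finset.Icc n N, r ^ k := by
        rw [Finset.mul_sum]; refine Finset.sum_congr rfl fun k _ => by ring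
    _ ≤ (1 / 2 : ℝ) * (X₀ / δ) ^ 2 * (r ^ n / (1 - r)) := by gcongr
    _ = (1 / (δ ^ 2 * (1 - r))) * ((1 / 2 : ℝ) * X₀ ^ 2) * r ^ n := by
        field_simp
    _ = _ := by rw [hrn]

end Literature.Analysis.FluidPDE

end
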